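import Mathlib
import Literature.MathematicalPhysics.QuantumFieldTheory.Balaban1983to89.B12Cubes436

/-!
# B12 [Balaban1987RG1] — the y-moment sums of (4.34) for X-summed kernels WITHOUT translation invariance,
# and the p. 290 exchanges (y-extension, «very small coefficients», X-sum inside) — bookkeeping

Bałaban, *Renormalization group approach to lattice gauge field theories. I. Generation of effective actions
in a small field approximation and a coupling constant renormalization in four dimensions*, Commun. Math.
Phys. **109** (1987) 249–301 [Balaban1987RG1] (PDF page = journal page − 248), §4 pp. 289–290; (5.10) p. 293.

CITATION HEADER (quotations verbatim from the renders `1987-cmp109-rg-I-small-field-p041-x2.png` (p. 289)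
and `-p042-x2.png` (p. 290), both read as images by this seat; «…» marks an elision):

* (4.34), p. 289–290 [PDF 41–42] — «Let us write the result of the preceding analysis
  (4.6) = Σ_{(x,μ),(y,ν)} 𝐄⁽²⁾_{μ,ν}(X, x, y) tr δB_μ(x)B_ν(y)
   + Σ_x Σ_{μ,ν,κ,λ} (Σ_y 𝐄⁽²⁾_{μ,ν}(X, x, y)(y_κ − x_κ)(y_λ − x_λ))
     × {tr δB_μ(x)i[B_κ(x), (∂_λB_ν)(x)] + ⅓ tr δB_μ(x)i[B_κ(x), i[B_λ(x), B_ν(x)]]}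
   + Σ_x Σ_{μ,ν,κ} (Σ_y 𝐄⁽²⁾_{μ,ν}(X, x, y)(y_κ − x_κ)) {½ tr δB_μ(x)i[B_κ(x), B_ν(x)] «…»
   − ¼ tr δB_μ(x)i[B_μ(x), i[B_κ(x), B_ν(x)]]} + (the irrelevant terms). (4.34)».  The three COEFFICIENT KERNELS
  `Σ_y 𝐄²(X,x,y)`, `Σ_y 𝐄²(X,x,y)(y_κ − x_κ)`, `Σ_y 𝐄²(X,x,y)(y_κ − x_κ)(y_λ − x_λ)` (summed over X) are the
  objects of this module; the field polynomials in braces are NOT touched (they are `B12Marginal444`'s).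
* p. 290 [42] — «The sums over x above are restricted to supp δB ⊂ □, and the sums over y are restricted to
  supp B ⊂ supp ζ̃_□. The expressions in this formula are local polynomials in the fields δB, B.»
* p. 290 [42] — «If we replace H_j(□₀) by H_j with free boundary conditions, then the difference H_j(□₀) − H_j
  restricted to X × supp ζ̃_□, yields the factor B₀ exp(−δ₀M(Lʲη)⁻¹) in a bound of the corresponding
  expression. Thus this change increases the sum of the irrelevant terms by the expression of the form (4.34),
  but with very small coefficients. Next, we extend summations over y to the whole lattice Z⁴. The difference
  between the sum over supp ζ̃_□ and the sum over Z⁴ is a sum over a subset of (□̃³)ᶜ∩Z⁴. This gives again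
  the exponentially small coefficients.»
* p. 290 [42] — «We extend it to all X ∈ 𝐃⁰_j, where 𝐃⁰_j is the class of localization domains constructed
  for the lattice ξZ⁴. «…» This means that we sum the function 𝐄⁽²⁾(X) over X ∈ 𝐃⁰_j, because the other
  expressions do not depend on X.»
* (5.10) p. 293 [45] is quoted in `B12Sec2to5.Decay510`; the printed rate `δ₁ = ½ min{δ₀, κM⁻¹}` is
  `B12Decay510.delta1`.

WHY THIS MODULE.  The lineage proved the y-moment / y-tail bookkeeping of (4.34) for TRANSLATION-INVARIANT
kernels `c(x − y)` (`B12WholeLattice290`, `B12Moments443`, `B12Cubes436` §4: the (5.10) kernel 𝓔², i.e. AFTER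
the X-extension), and the KERNEL BOUND ⇒ two-point bound `|Σ'_X 𝐄²(X,x,y)| ≤ A e^{−δ₁|x−y|₁}` for the X-summed
kernel over any class (`B12Ext436Lattice.twoPoint_latt`, `B12HjFree290.twoPoint_latt_restr_sub`).  At the two
p. 290 steps that come BEFORE the X-extension — the replacement H_j(□₀) → H_j («the expression of the form
(4.34), but with very small coefficients») and the y-extension («a sum over a subset of (□̃³)ᶜ∩Z⁴») — the kernel
is `Σ_{X ⊂ □̃²} 𝐄²(X,x,y)`, which is NOT translation invariant: only the two-point bound is available.  This
module supplies the missing [folklore] link: the y-moment sums of (4.34) for an ARBITRARY kernel under a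
two-point bound, with the SAME constants `S_{a,p,d}` as the translation-invariant case, the exchange of the
X-sum with the (infinite) y-sum, and the instances on 𝐃⁰_j(ℤᵈ) at the printed δ₁ — in particular for the
replacement difference, whose coefficient kernels come out `∝ η` (the [15]-factor), as print says.

WHAT THIS MODULE PROVES ([folklore] real analysis on ℤᵈ, or one-line instantiations of lineage capstones):
* §0 dictionary lemmas: `wt_eq`, `S_zero_eq_K₁`, `kappa_pos_of`, `delta1_latt_pos`, and the
  domination of the moment monomials by the polynomial weight, `abs_coord_le_pw`, `abs_coord2_le_pw`.
* §1 for a kernel `K(x,y)` on ℤᵈ with `|K(x,y)| ≤ A e^{−a|x−y|₁}` at a site `x` (`a > 0`):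
  `Σ_{y∈ℤᵈ} |K(x,y)| pw_p(x − y)` converges and is `≤ A·S_{a,p,d}` (`tsum_abs_mul_pw_le`), as are its
  restrictions to finite / arbitrary y-ranges; the three coefficient kernels of (4.34): `Σ_y |K| ≤ A S_{a,0,d}`,
  `|Σ_y K(x,y)(y_κ − x_κ)| ≤ A S_{a,1,d}`, `|Σ_y K(x,y)(y_κ − x_κ)(y_λ − x_λ)| ≤ A S_{a,2,d}` over ℤᵈ (absolutely
  convergent) and over every finite `Y` (`moment0_le`, `moment1_le`, `moment2_le`); general weights of polynomial
  growth, real `|w(y)| ≤ K_w pw_p(x − y)` and complex `‖F(z)‖ ≤ K_F pw_p(z)`; and the p. 290 y-TAIL without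
  translation invariance: for `V`-valued `G` with `‖G(y)‖ ≤ B e^{−a|x−y|₁}pw_p(x − y)` and finite
  `Y ⊇ {y : |x − y|₁ < R}`, `‖Σ_{y∈ℤᵈ} G − Σ_{y∈Y} G‖ ≤ B e^{−(a/2)R} S_{a/2,p,d}` (`norm_tsum_sub_sum_le_of_shift`,
  `tail434_le`, `tail434_real_le`).
* §2 «because the other expressions do not depend on X», with y already over ℤᵈ: for a family `𝐄(X,x,y)`
  (X in any index type) whose finite partial X-sums obey the two-point bound uniformly and a weight
  `|w(y)| ≤ K_w pw_p(x − y)`, the double family `(X,y) ↦ 𝐄(X,x,y)w(y)` is summable (`summable_prod434`) and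
  `Σ'_X Σ_{y∈ℤᵈ} 𝐄(X,x,y)w(y) = Σ_{y∈ℤᵈ} (Σ'_X 𝐄(X,x,y)) w(y)` (`fubini434`); sub-classes inherit the bound.
* §3 on 𝐃⁰_j(ℤᵈ) under `KernelBound E2 C_E κ δ₀` (`κ ≥ 2κ₀(4·2ᵈ,2d)`, `δ₀ > 0`, cube side `M ≥ 1`, `d ≥ 1`), at
  the printed `δ₁` and with `A = C_E e^{3Mdδ₁} K₀(4·2ᵈ,2d) K₁(d,δ₀/2)`: finite families and every sub-class
  `{X : P X}` (print's `X ⊂ □̃²`, the far class, the whole class) obey the two-point bound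
  (`sum_abs_latt_le`, `twoPoint_latt_subtype`), hence all of §1–§2: `moments434_latt`, `coeff434_latt`,
  `tail434_latt`, `fubini434_latt`.
* §4 the replacement H_j(□₀) → H_j: `B12HjFree290.kernelBound_restr_sub` gives the S×S-restricted difference
  kernel the kernel bound with `C_E = 8E₀α₂⁻²B₃η`, so each coefficient kernel of (4.34) written for the
  difference is `≤ (8E₀α₂⁻²B₃η)·e^{3Mdδ₁}K₀K₁(d,δ₀/2)·S_{δ₁,p,d}` (`coeff434_restr_sub`) — «the expression of
  the form (4.34), but with very small coefficients», linear in the factor η, which remains the parents'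
  NAMED HYPOTHESIS `hdiff`.
* §5 print's ranges with `B12Cubes436`: `x ∈ □`, y over a finite site set `SF` with `□̃³ ⊆ SF` (collar unit
  `R₀ > 0`): the y-extension error of any polynomially weighted two-point-bounded kernel sum is
  `≤ A K e^{−(a/2)·3R₀} S_{a/2,p,d}` (`tail434_box_le`); and consistency: a (5.10)-type translation-invariant
  kernel is a two-point-bounded kernel (`twoPt_of_decay510`), so §1 contains the lineage's case.

WHAT IT DOES NOT PROVE.  Nothing analytic: (4.4)/(1.18), the p. 282 response bounds and the [15] bound on
H_j(□₀) − H_j stay the parents' named hypotheses (`han`, `h118`, `hh₀`, `hh`, `hdiff`); the kernel bound is a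
hypothesis (`hE`) except where `B12HjFree290` derives it; the field polynomials of (4.34), the first block
⟨𝐄²(X), δB, B⟩ (analysed in §5 of the paper) and the second locus (4.40) p. 291 are not touched; the smooth
`ζ̃_□` is not modelled (any site set between □̃³ and □̃⁴, as in `B12Cubes436`); Euclidean |x − y| is read ℓ¹
(lineage D-b03.29).  NOT summit progress.

DICTIONARY / DIVERGENCE (D-b03.34): (i) «supp ζ̃_□» ↦ an arbitrary finite site set `Y` / `SF`;
(ii) |x − y| ↦ |x − y|₁ = `B12Sec2to5.l1 (x - y)` (`PeriodicGleason.l1` is the same function, `wt_eq`);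
(iii) the moment monomials are dominated by `PeriodicGleason.pw p (x - y) = Π_j(|x_j − y_j| + 1)^p`, so the
constants are the lineage's `B12WholeLattice290.S a p d = Σ_{z∈ℤᵈ} e^{−a|z|₁} pw_p(z)` (`S a 0 d = K₁ d a`);
(iv) the "size of a coefficient" of a (4.34) block at the site x ↦ the absolutely convergent y-sum of
|kernel × monomial| (the field factor at x is constant in y and not estimated here); (v) the X-index of §2
is an arbitrary type (`LDom d` or a subtype of it in §3–§4).
-/

namespace Literature.MathematicalPhysics.QuantumFieldTheory.Balaban1983to89.B12MomentSums434

open Literature.MathematicalPhysics.QuantumFieldTheory.Balaban1983to89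
open Literature.MathematicalPhysics.QuantumFieldTheory.GawedzkiKupiainen1985.PeriodicGleason
  (pw pw_pos pw_zero_exp wt wt_pos summable_wt_pw)
open Literature.MathematicalPhysics.QuantumFieldTheory.Balaban1983to89.B13ScaleTransfer (Pt)
open Literature.MathematicalPhysics.QuantumFieldTheory.Balaban1983to89.TreeLength (treeLen)
open Literature.MathematicalPhysics.QuantumFieldTheory.Balaban1983to89.B12TreeDecay (kappa₀ K₀ K₀_pos)
open Literature.MathematicalPhysics.QuantumFieldTheory.Balaban1983to89.B12Decay510
  (mixedDeriv delta1 delta1_nonneg delta1_pos delta1_mul_le delta1_le_half)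
open Literature.MathematicalPhysics.QuantumFieldTheory.Balaban1983to89.B12Decay510Window (K₁ K₁_nonneg)
open Literature.MathematicalPhysics.QuantumFieldTheory.Balaban1983to89.B12Sec2to5 (l1 l1_nonneg Decay510)
open Literature.MathematicalPhysics.QuantumFieldTheory.Balaban1983to89.B12Ext436
  (summable_and_tsum_le_of_sum_le summable_and_abs_tsum_le_of_sum_abs_le)
open Literature.MathematicalPhysics.QuantumFieldTheory.Balaban1983to89.B12Ext436Lattice
  (LDom geomZ geomLeafZ cubeSumLeafZ ineq126_latt kappa_nonneg_of)
open Literature.MathematicalPhysics.QuantumFieldTheory.Balaban1983to89.B12HjFree290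
  (kernelBound_restr_sub summable_and_abs_tsum_subtype_le)
open Literature.MathematicalPhysics.QuantumFieldTheory.Balaban1983to89.B12WholeLattice290
  (wt_le_exp_mul_wt_half norm_neg_coord_le_pw norm_coord2_le_pw)
open Literature.MathematicalPhysics.QuantumFieldTheory.Balaban1983to89.B12Cubes436 (mem_suppZeta_of_l1_lt)
open Set Metric

variable {d : ℕ}

/-! ## 0. Dictionary lemmas -/

/-- `PeriodicGleason.wt a z = e^{−a|z|₁}` with the B12 ℓ¹ length `B12Sec2to5.l1` (the two `l1` are one
function). [folklore] -/
theorem wt_eq (a : ℝ) (z : Pt d) : wt a z = Real.exp (-a * l1 z) := rfl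

/-- `S_{a,0,d} = K₁(d, a)`: the zeroth constant is the cube-sum constant of `B12Decay510Window`. [folklore] -/
theorem S_zero_eq_K₁ (a : ℝ) (d : ℕ) : B12WholeLattice290.S a 0 d = K₁ d a := by
  unfold B12WholeLattice290.S K₁
  exact tsum_congr fun z => by rw [pw_zero_exp, mul_one]; rfl

/-- A threshold `κ₀(4·2ᵈ, 2d) ≤ κ/t` with `t > 0` forces `κ > 0`, since `κ₀(c₀, Δ) = c₀ log(2(Δ+1)²) > 0`
(the latter is `Beta.RemainderChainLattice.kappa₀_pos`, deliberately not imported: the B12 lineage stays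
upstream of the β-cell). [folklore] -/
theorem kappa_pos_of {κ t : ℝ} (ht : 0 < t) (hκ₀ : kappa₀ (4 * 2 ^ d) (2 * d) ≤ κ / t) : 0 < κ := by
  have h0 : (0 : ℝ) ≤ ((2 * d : ℕ) : ℝ) := Nat.cast_nonneg _
  have h1 : (1 : ℝ) ≤ (((2 * d : ℕ) : ℝ) + 1) ^ 2 := one_le_pow₀ (by linarith)
  have hk : 0 < kappa₀ (4 * 2 ^ d) (2 * d) := by
    show (0 : ℝ) < 4 * 2 ^ d * Real.log (2 * (((2 * d : ℕ) : ℝ) + 1) ^ 2)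
    exact mul_pos (by positivity) (Real.log_pos (by linarith))
  have h2 := (lt_div_iff₀ ht).1 (hk.trans_le hκ₀)
  rw [zero_mul] at h2
  exact h2

/-- The printed rate `δ₁ = ½ min{δ₀, κ(Md)⁻¹}` of the ℤᵈ capstones is positive (`δ₀ > 0`, κ above a
threshold, `M, d ≥ 1`). [cite: Balaban1987RG1, (5.10) p.293] -/
theorem delta1_latt_pos (hd : 0 < d) {M : ℕ} (hM : 0 < M) {κ δ₀ t : ℝ} (ht : 0 < t) (hδ₀ : 0 < δ₀)
    (hκ₀ : kappa₀ (4 * 2 ^ d) (2 * d) ≤ κ / t) : 0 < delta1 δ₀ κ ((M : ℝ) * d) :=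
  delta1_pos hδ₀ (kappa_pos_of ht hκ₀) (mul_pos (Nat.cast_pos.2 hM) (Nat.cast_pos.2 hd))

/-- The first-moment monomial of (4.34) is dominated by the polynomial weight: `|y_κ − x_κ| ≤ pw_1(x − y)`.
[folklore] -/
theorem abs_coord_le_pw (κ : Fin d) (x y : Pt d) : |((y κ - x κ : ℤ) : ℝ)| ≤ pw 1 (x - y) := by
  have h := norm_neg_coord_le_pw κ (x - y)
  rw [norm_neg, one_mul, Complex.norm_intCast, Pi.sub_apply, Int.cast_sub] at h
  rw [Int.cast_sub, abs_sub_comm]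
  exact h

/-- The second-moment monomial of (4.34): `|(y_κ − x_κ)(y_λ − x_λ)| ≤ pw_2(x − y)`. [folklore] -/
theorem abs_coord2_le_pw (κ l : Fin d) (x y : Pt d) :
    |((y κ - x κ : ℤ) : ℝ) * ((y l - x l : ℤ) : ℝ)| ≤ pw 2 (x - y) := by
  have h := norm_coord2_le_pw κ l (x - y)
  rw [norm_mul, one_mul, Complex.norm_intCast, Complex.norm_intCast, Pi.sub_apply, Pi.sub_apply,
    Int.cast_sub, Int.cast_sub] at h
  rw [abs_mul, Int.cast_sub, Int.cast_sub, abs_sub_comm ((y κ : ℤ) : ℝ), abs_sub_comm ((y l : ℤ) : ℝ)]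
  exact h

/-! ## 1. A kernel on ℤᵈ under the two-point bound: the y-moment sums of (4.34) converge, uniformly in x

No translation invariance is assumed: `K x y` is any real kernel with `|K(x,y)| ≤ A e^{−a|x − y|₁}` at the
site `x` under consideration. -/

section TwoPoint

variable {K : Pt d → Pt d → ℝ} {A a : ℝ}

/-- The two-point bound at `y = x` forces `0 ≤ A`. [folklore] -/
theorem nonneg_of_twoPt {x : Pt d} (hK : ∀ y, |K x y| ≤ A * Real.exp (-a * l1 (x - y))) : 0 ≤ A := by
  have h := hK x
  rw [sub_self] at h
  have h0 : l1 (0 : Pt d) = 0 := by simp [l1]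
  rw [h0, mul_zero, Real.exp_zero, mul_one] at h
  exact (abs_nonneg _).trans h

/-- The shifted majorant `e^{−a|x − y|₁} pw_p(x − y)` is summable in `y` (change of variables `y = x − z`,
`PeriodicGleason.summable_wt_pw`). [folklore] -/
theorem summable_wt_pw_shift (ha : 0 < a) (p : ℕ) (x : Pt d) :
    Summable fun y : Pt d => wt a (x - y) * pw p (x - y) :=
  ((Equiv.subLeft x).summable_iff.2 (summable_wt_pw ha p d)).congr fun y => by
    simp only [Function.comp_apply, Equiv.subLeft_apply]

/-- `Σ_{y∈ℤᵈ} e^{−a|x − y|₁} pw_p(x − y) = S_{a,p,d}`, for every `x`. [folklore] -/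
theorem tsum_wt_pw_shift (a : ℝ) (p : ℕ) (x : Pt d) :
    ∑' y : Pt d, wt a (x - y) * pw p (x - y) = B12WholeLattice290.S a p d :=
  (Equiv.subLeft x).tsum_eq fun z => wt a z * pw p z

/-- Pointwise: `|K(x,y)| pw_p(x − y) ≤ A·(e^{−a|x − y|₁} pw_p(x − y))`. [folklore] -/
theorem abs_mul_pw_le {x : Pt d} (hK : ∀ y, |K x y| ≤ A * Real.exp (-a * l1 (x - y))) (p : ℕ)
    (y : Pt d) : |K x y| * pw p (x - y) ≤ A * (wt a (x - y) * pw p (x - y)) := by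
  rw [wt_eq, ← mul_assoc]
  exact mul_le_mul_of_nonneg_right (hK y) (pw_pos p (x - y)).le

/-- **The weighted y-sums converge**: `Σ_y |K(x,y)| pw_p(x − y) < ∞`. [folklore] -/
theorem summable_abs_mul_pw (ha : 0 < a) {x : Pt d}
    (hK : ∀ y, |K x y| ≤ A * Real.exp (-a * l1 (x - y))) (p : ℕ) :
    Summable fun y => |K x y| * pw p (x - y) :=
  Summable.of_nonneg_of_le (fun _ => mul_nonneg (abs_nonneg _) (pw_pos p _).le) (abs_mul_pw_le hK p)
    ((summable_wt_pw_shift ha p x).mul_left A)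

/-- **The uniform bound** `Σ_{y∈ℤᵈ} |K(x,y)| pw_p(x − y) ≤ A·S_{a,p,d}` — the constant depends on the
kernel only through `(A, a)` and not on `x`. [folklore] -/
theorem tsum_abs_mul_pw_le (ha : 0 < a) {x : Pt d}
    (hK : ∀ y, |K x y| ≤ A * Real.exp (-a * l1 (x - y))) (p : ℕ) :
    ∑' y, |K x y| * pw p (x - y) ≤ A * B12WholeLattice290.S a p d :=
  calc ∑' y, |K x y| * pw p (x - y) ≤ ∑' y, A * (wt a (x - y) * pw p (x - y)) :=
        Summable.tsum_le_tsum (abs_mul_pw_le hK p) (summable_abs_mul_pw ha hK p)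
          ((summable_wt_pw_shift ha p x).mul_left A)
    _ = A * B12WholeLattice290.S a p d := by rw [tsum_mul_left, tsum_wt_pw_shift]

/-- Finite y-ranges (print's `supp B ⊂ supp ζ̃_□`, any finite `Y`):
`Σ_{y∈Y} |K(x,y)| pw_p(x − y) ≤ A·S_{a,p,d}`. [folklore] -/
theorem sum_abs_mul_pw_le (ha : 0 < a) {x : Pt d}
    (hK : ∀ y, |K x y| ≤ A * Real.exp (-a * l1 (x - y))) (p : ℕ) (Y : Finset (Pt d)) :
    ∑ y ∈ Y, |K x y| * pw p (x - y) ≤ A * B12WholeLattice290.S a p d :=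
  ((summable_abs_mul_pw ha hK p).sum_le_tsum Y fun _ _ => mul_nonneg (abs_nonneg _) (pw_pos p _).le).trans
    (tsum_abs_mul_pw_le ha hK p)

/-- Arbitrary y-ranges `T ⊆ ℤᵈ`: `Σ_{y∈T} |K(x,y)| pw_p(x − y) ≤ A·S_{a,p,d}`. [folklore] -/
theorem tsum_subtype_abs_mul_pw_le (ha : 0 < a) {x : Pt d}
    (hK : ∀ y, |K x y| ≤ A * Real.exp (-a * l1 (x - y))) (p : ℕ) (T : Set (Pt d)) :
    ∑' y : T, |K x (y : Pt d)| * pw p (x - (y : Pt d)) ≤ A * B12WholeLattice290.S a p d :=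
  ((summable_abs_mul_pw ha hK p).tsum_subtype_le (fun y => |K x y| * pw p (x - y)) T
    fun _ => mul_nonneg (abs_nonneg _) (pw_pos p _).le).trans (tsum_abs_mul_pw_le ha hK p)

/-- **(4.34), zeroth moments** (the kernel itself): `K(x,·)` is absolutely summable over ℤᵈ,
`Σ_y |K(x,y)| ≤ A·S_{a,0,d}` (`= A·K₁(d,a)`, `S_zero_eq_K₁`) and `|Σ_y K(x,y)| ≤ A·S_{a,0,d}`.
[cite: Balaban1987RG1, (4.34) p.289] -/
theorem moment0_le (ha : 0 < a) {x : Pt d} (hK : ∀ y, |K x y| ≤ A * Real.exp (-a * l1 (x - y))) :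
    Summable (K x) ∧ ∑' y, |K x y| ≤ A * B12WholeLattice290.S a 0 d ∧
      |∑' y, K x y| ≤ A * B12WholeLattice290.S a 0 d := by
  have hs : Summable fun y => |K x y| := by simpa using summable_abs_mul_pw ha hK 0
  have ht : ∑' y, |K x y| ≤ A * B12WholeLattice290.S a 0 d := by simpa using tsum_abs_mul_pw_le ha hK 0
  have hu : ∀ u : Finset (Pt d), ∑ y ∈ u, |K x y| ≤ A * B12WholeLattice290.S a 0 d := fun u => by
    simpa using sum_abs_mul_pw_le ha hK 0 u
  exact ⟨hs.of_abs, ht, (summable_and_abs_tsum_le_of_sum_abs_le (K x) hu).2⟩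

/-- **(4.34), first moments** (the coefficient kernel `Σ_y K(x,y)(y_κ − x_κ)` of the third block): absolutely
summable over `y ∈ ℤᵈ`, `Σ_y |K(x,y)(y_κ − x_κ)| ≤ A·S_{a,1,d}`, hence `|Σ_{y∈ℤᵈ} K(x,y)(y_κ − x_κ)| ≤ A·S_{a,1,d}`
and the same over every finite y-range. [cite: Balaban1987RG1, (4.34) p.289] -/
theorem moment1_le (ha : 0 < a) {x : Pt d} (hK : ∀ y, |K x y| ≤ A * Real.exp (-a * l1 (x - y)))
    (κ : Fin d) :
    Summable (fun y => K x y * ((y κ - x κ : ℤ) : ℝ)) ∧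
    ∑' y, |K x y * ((y κ - x κ : ℤ) : ℝ)| ≤ A * B12WholeLattice290.S a 1 d ∧
    |∑' y, K x y * ((y κ - x κ : ℤ) : ℝ)| ≤ A * B12WholeLattice290.S a 1 d ∧
    ∀ Y : Finset (Pt d), |∑ y ∈ Y, K x y * ((y κ - x κ : ℤ) : ℝ)| ≤ A * B12WholeLattice290.S a 1 d := by
  have hpt : ∀ y, |K x y * ((y κ - x κ : ℤ) : ℝ)| ≤ |K x y| * pw 1 (x - y) := fun y => by
    rw [abs_mul]; exact mul_le_mul_of_nonneg_left (abs_coord_le_pw κ x y) (abs_nonneg _)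
  have hu : ∀ u : Finset (Pt d), ∑ y ∈ u, |K x y * ((y κ - x κ : ℤ) : ℝ)| ≤
      A * B12WholeLattice290.S a 1 d :=
    fun u => (Finset.sum_le_sum fun y _ => hpt y).trans (sum_abs_mul_pw_le ha hK 1 u)
  obtain ⟨hs, habs⟩ := summable_and_abs_tsum_le_of_sum_abs_le (fun y => K x y * ((y κ - x κ : ℤ) : ℝ)) hu
  refine ⟨hs, ?_, habs, fun Y => (Finset.abs_sum_le_sum_abs _ _).trans (hu Y)⟩
  exact (Summable.tsum_le_tsum hpt hs.abs (summable_abs_mul_pw ha hK 1)).trans (tsum_abs_mul_pw_le ha hK 1)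

/-- **(4.34), second moments** (the coefficient kernel `Σ_y K(x,y)(y_κ − x_κ)(y_λ − x_λ)` of the second
block): absolutely summable over `y ∈ ℤᵈ`, `Σ_y |K(x,y)(y_κ − x_κ)(y_λ − x_λ)| ≤ A·S_{a,2,d}`, hence
`|Σ_{y∈ℤᵈ} K(x,y)(y_κ − x_κ)(y_λ − x_λ)| ≤ A·S_{a,2,d}` and the same over every finite y-range — the
δ₁-dependent constant of the second-moment extraction (the β-cell proviso of `Beta/ReplacementRates`) is
`S_{δ₁,2,d}` at `a = δ₁`. [cite: Balaban1987RG1, (4.34) p.289] -/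
theorem moment2_le (ha : 0 < a) {x : Pt d} (hK : ∀ y, |K x y| ≤ A * Real.exp (-a * l1 (x - y)))
    (κ l : Fin d) :
    Summable (fun y => K x y * (((y κ - x κ : ℤ) : ℝ) * ((y l - x l : ℤ) : ℝ))) ∧
    ∑' y, |K x y * (((y κ - x κ : ℤ) : ℝ) * ((y l - x l : ℤ) : ℝ))| ≤ A * B12WholeLattice290.S a 2 d ∧
    |∑' y, K x y * (((y κ - x κ : ℤ) : ℝ) * ((y l - x l : ℤ) : ℝ))| ≤ A * B12WholeLattice290.S a 2 d ∧
    ∀ Y : Finset (Pt d), |∑ y ∈ Y, K x y * (((y κ - x κ : ℤ) : ℝ) * ((y l - x l : ℤ) : ℝ))| ≤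
      A * B12WholeLattice290.S a 2 d := by
  have hpt : ∀ y, |K x y * (((y κ - x κ : ℤ) : ℝ) * ((y l - x l : ℤ) : ℝ))| ≤ |K x y| * pw 2 (x - y) :=
    fun y => by
      rw [abs_mul]; exact mul_le_mul_of_nonneg_left (abs_coord2_le_pw κ l x y) (abs_nonneg _)
  have hu : ∀ u : Finset (Pt d), ∑ y ∈ u, |K x y * (((y κ - x κ : ℤ) : ℝ) * ((y l - x l : ℤ) : ℝ))| ≤
      A * B12WholeLattice290.S a 2 d :=
    fun u => (Finset.sum_le_sum fun y _ => hpt y).trans (sum_abs_mul_pw_le ha hK 2 u)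
  obtain ⟨hs, habs⟩ := summable_and_abs_tsum_le_of_sum_abs_le
    (fun y => K x y * (((y κ - x κ : ℤ) : ℝ) * ((y l - x l : ℤ) : ℝ))) hu
  refine ⟨hs, ?_, habs, fun Y => (Finset.abs_sum_le_sum_abs _ _).trans (hu Y)⟩
  exact (Summable.tsum_le_tsum hpt hs.abs (summable_abs_mul_pw ha hK 2)).trans (tsum_abs_mul_pw_le ha hK 2)

/-! ### General weights of polynomial growth, and the y-tail without translation invariance

The tail lemmas are stated for a `V`-valued family `G` dominated by the shifted majorant
`B e^{−a|x − y|₁} pw_p(x − y)`; `V = ℝ` serves the three real coefficient kernels, `V = ℂ` the complex moment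
conventions of `B12Moments443` / `B12WholeLattice290`. -/

variable {V : Type*} [NormedAddCommGroup V]

/-- A family under the shifted majorant is summable (`V` complete). [folklore] -/
theorem summable_of_shift [CompleteSpace V] {G : Pt d → V} {B : ℝ} (ha : 0 < a) (x : Pt d) (p : ℕ)
    (hG : ∀ y, ‖G y‖ ≤ B * (wt a (x - y) * pw p (x - y))) : Summable G :=
  Summable.of_norm_bounded ((summable_wt_pw_shift ha p x).mul_left B) hG

/-- … with `‖Σ_{y∈ℤᵈ} G(y)‖ ≤ B·S_{a,p,d}`. [folklore] -/
theorem norm_tsum_le_of_shift {G : Pt d → V} {B : ℝ} (ha : 0 < a) (x : Pt d) (p : ℕ)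
    (hG : ∀ y, ‖G y‖ ≤ B * (wt a (x - y) * pw p (x - y))) :
    ‖∑' y, G y‖ ≤ B * B12WholeLattice290.S a p d :=
  calc ‖∑' y, G y‖ ≤ ∑' y, B * (wt a (x - y) * pw p (x - y)) :=
        tsum_of_norm_bounded ((summable_wt_pw_shift ha p x).mul_left B).hasSum hG
    _ = B * B12WholeLattice290.S a p d := by rw [tsum_mul_left, tsum_wt_pw_shift]

/-- … and `‖Σ_{y∈Y} G(y)‖ ≤ B·S_{a,p,d}` for every finite `Y`. [folklore] -/
theorem norm_sum_le_of_shift {G : Pt d → V} {B : ℝ} (ha : 0 < a) (hB : 0 ≤ B) (x : Pt d) (p : ℕ)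
    (hG : ∀ y, ‖G y‖ ≤ B * (wt a (x - y) * pw p (x - y))) (Y : Finset (Pt d)) :
    ‖∑ y ∈ Y, G y‖ ≤ B * B12WholeLattice290.S a p d :=
  calc ‖∑ y ∈ Y, G y‖ ≤ ∑ y ∈ Y, B * (wt a (x - y) * pw p (x - y)) := norm_sum_le_of_le Y fun y _ => hG y
    _ ≤ ∑' y, B * (wt a (x - y) * pw p (x - y)) :=
        ((summable_wt_pw_shift ha p x).mul_left B).sum_le_tsum Y fun y _ =>
          mul_nonneg hB (mul_nonneg (wt_pos _ _).le (pw_pos p _).le)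
    _ = B * B12WholeLattice290.S a p d := by rw [tsum_mul_left, tsum_wt_pw_shift]

/-- **The y-tail WITHOUT translation invariance**: `‖Σ_{y∉Y} G(y)‖ ≤ B·e^{−(a/2)R}·S_{a/2,p,d}` for every
finite `Y ⊇ {y : |x − y|₁ < R}` (one half of the rate pays for the radius,
`B12WholeLattice290.wt_le_exp_mul_wt_half`; compare `B12WholeLattice290.norm_tsum_compl_le`, which needs the
kernel to be a function of `x − y`). [folklore] -/
theorem norm_tsum_compl_le_of_shift {G : Pt d → V} {B : ℝ} (ha : 0 < a) (hB : 0 ≤ B) (x : Pt d) (p : ℕ)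
    (hG : ∀ y, ‖G y‖ ≤ B * (wt a (x - y) * pw p (x - y))) (R : ℝ) (Y : Finset (Pt d))
    (hY : ∀ y, l1 (x - y) < R → y ∈ Y) :
    ‖∑' y : ↑((↑Y : Set (Pt d))ᶜ), G y‖ ≤
      B * Real.exp (-(a / 2) * R) * B12WholeLattice290.S (a / 2) p d := by
  set g : Pt d → ℝ := fun y => B * Real.exp (-(a / 2) * R) * (wt (a / 2) (x - y) * pw p (x - y))
    with hg_def
  have hg : Summable g := (summable_wt_pw_shift (half_pos ha) p x).mul_left _
  have hg0 : ∀ y, 0 ≤ g y := fun y =>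
    mul_nonneg (mul_nonneg hB (Real.exp_pos _).le) (mul_nonneg (wt_pos _ _).le (pw_pos p _).le)
  have hle : ∀ y : ↑((↑Y : Set (Pt d))ᶜ), ‖G y‖ ≤ g y := fun y => by
    have hy : (y : Pt d) ∉ Y := by
      have h2 := y.2
      rw [Set.mem_compl_iff, Finset.mem_coe] at h2
      exact h2
    have hR : R ≤ l1 (x - (y : Pt d)) := not_lt.1 fun h => hy (hY _ h)
    have hw : wt a (x - (y : Pt d)) ≤ Real.exp (-(a / 2) * R) * wt (a / 2) (x - (y : Pt d)) :=
      wt_le_exp_mul_wt_half ha.le hR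
    calc ‖G y‖ ≤ B * (wt a (x - (y : Pt d)) * pw p (x - (y : Pt d))) := hG y
      _ ≤ B * ((Real.exp (-(a / 2) * R) * wt (a / 2) (x - (y : Pt d))) * pw p (x - (y : Pt d))) :=
          mul_le_mul_of_nonneg_left (mul_le_mul_of_nonneg_right hw (pw_pos p _).le) hB
      _ = g y := by simp only [hg_def]; ring
  calc ‖∑' y : ↑((↑Y : Set (Pt d))ᶜ), G y‖ ≤ ∑' y : ↑((↑Y : Set (Pt d))ᶜ), g y :=
        tsum_of_norm_bounded (hg.subtype _).hasSum hle
    _ ≤ ∑' y, g y := hg.tsum_subtype_le g _ hg0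
    _ = B * Real.exp (-(a / 2) * R) * B12WholeLattice290.S (a / 2) p d := by
        simp only [hg_def, tsum_mul_left, tsum_wt_pw_shift]

/-- **The y-tail, difference form**: `‖Σ_{y∈ℤᵈ} G(y) − Σ_{y∈Y} G(y)‖ ≤ B·e^{−(a/2)R}·S_{a/2,p,d}` for finite
`Y ⊇ {y : |x − y|₁ < R}`. [folklore] -/
theorem norm_tsum_sub_sum_le_of_shift [CompleteSpace V] {G : Pt d → V} {B : ℝ} (ha : 0 < a) (hB : 0 ≤ B)
    (x : Pt d)
    (p : ℕ) (hG : ∀ y, ‖G y‖ ≤ B * (wt a (x - y) * pw p (x - y))) (R : ℝ) (Y : Finset (Pt d))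
    (hY : ∀ y, l1 (x - y) < R → y ∈ Y) :
    ‖∑' y, G y - ∑ y ∈ Y, G y‖ ≤ B * Real.exp (-(a / 2) * R) * B12WholeLattice290.S (a / 2) p d := by
  have hsplit : ∑ y ∈ Y, G y + ∑' y : ↑((↑Y : Set (Pt d))ᶜ), G y = ∑' y, G y := by
    have h := (summable_of_shift ha x p hG).tsum_subtype_add_tsum_subtype_compl (↑Y : Set (Pt d))
    rw [Finset.tsum_subtype' Y G] at h
    exact h
  rw [← hsplit, add_sub_cancel_left]
  exact norm_tsum_compl_le_of_shift ha hB x p hG R Y hY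

/-- Real weights of polynomial growth, `|w(y)| ≤ K_w pw_p(x − y)` (the monomials of (4.34) have `K_w = 1`,
`p = 0, 1, 2`): `‖K(x,y) w(y)‖ ≤ A K_w (e^{−a|x−y|₁} pw_p(x − y))`. [folklore] -/
theorem norm_mul_real_weight_le {x : Pt d} (hK : ∀ y, |K x y| ≤ A * Real.exp (-a * l1 (x - y)))
    {w : Pt d → ℝ} {KW : ℝ} {p : ℕ} (hw : ∀ y, |w y| ≤ KW * pw p (x - y)) (y : Pt d) :
    ‖K x y * w y‖ ≤ A * KW * (wt a (x - y) * pw p (x - y)) := by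
  rw [Real.norm_eq_abs, abs_mul, wt_eq]
  calc |K x y| * |w y| ≤ (A * Real.exp (-a * l1 (x - y))) * (KW * pw p (x - y)) :=
        mul_le_mul (hK y) (hw y) (abs_nonneg _) ((abs_nonneg _).trans (hK y))
    _ = A * KW * (Real.exp (-a * l1 (x - y)) * pw p (x - y)) := by ring

/-- **(4.34) with a general real weight**: `Σ_y K(x,y) w(y)` is summable over ℤᵈ,
`|Σ_{y∈ℤᵈ} K(x,y) w(y)| ≤ A K_w S_{a,p,d}` and `|Σ_{y∈Y} K(x,y) w(y)| ≤ A K_w S_{a,p,d}` for every finite `Y`.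
[cite: Balaban1987RG1, (4.34) p.289] -/
theorem weighted434_le (ha : 0 < a) {x : Pt d} (hK : ∀ y, |K x y| ≤ A * Real.exp (-a * l1 (x - y)))
    {w : Pt d → ℝ} {KW : ℝ} {p : ℕ} (hKW : 0 ≤ KW) (hw : ∀ y, |w y| ≤ KW * pw p (x - y)) :
    Summable (fun y => K x y * w y) ∧ |∑' y, K x y * w y| ≤ A * KW * B12WholeLattice290.S a p d ∧
      ∀ Y : Finset (Pt d), |∑ y ∈ Y, K x y * w y| ≤ A * KW * B12WholeLattice290.S a p d := by
  have hG := norm_mul_real_weight_le hK hw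
  have hB : 0 ≤ A * KW := mul_nonneg (nonneg_of_twoPt hK) hKW
  refine ⟨summable_of_shift ha x p hG, ?_, fun Y => ?_⟩
  · rw [← Real.norm_eq_abs]; exact norm_tsum_le_of_shift ha x p hG
  · rw [← Real.norm_eq_abs]; exact norm_sum_le_of_shift ha hB x p hG Y

/-- **The p. 290 y-extension for a real-weighted two-point-bounded kernel** («The difference between the sum
over supp ζ̃_□ and the sum over Z⁴ is a sum over a subset of (□̃³)ᶜ∩Z⁴. This gives again the exponentially
small coefficients» — for the kernel AS IT STANDS there, which is not translation invariant): for finite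
`Y ⊇ {y : |x − y|₁ < R}`, `|Σ_{y∈ℤᵈ} K(x,y)w(y) − Σ_{y∈Y} K(x,y)w(y)| ≤ A K_w e^{−(a/2)R} S_{a/2,p,d}`.
[cite: Balaban1987RG1, p.290] -/
theorem tail434_real_le (ha : 0 < a) {x : Pt d} (hK : ∀ y, |K x y| ≤ A * Real.exp (-a * l1 (x - y)))
    {w : Pt d → ℝ} {KW : ℝ} {p : ℕ} (hKW : 0 ≤ KW) (hw : ∀ y, |w y| ≤ KW * pw p (x - y)) (R : ℝ)
    (Y : Finset (Pt d)) (hY : ∀ y, l1 (x - y) < R → y ∈ Y) :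
    |∑' y, K x y * w y - ∑ y ∈ Y, K x y * w y| ≤
      A * KW * Real.exp (-(a / 2) * R) * B12WholeLattice290.S (a / 2) p d := by
  rw [← Real.norm_eq_abs]
  exact norm_tsum_sub_sum_le_of_shift ha (mul_nonneg (nonneg_of_twoPt hK) hKW) x p
    (norm_mul_real_weight_le hK hw) R Y hY

/-- Complex weights as a function of `x − y` with `‖F(z)‖ ≤ K_F pw_p(z)` (the conventions of
`B12WholeLattice290` / `B12Moments443`): `‖K(x,y)F(x − y)‖ ≤ A K_F (e^{−a|x−y|₁} pw_p(x − y))`. [folklore] -/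
theorem norm_mul_weight_le {x : Pt d} (hK : ∀ y, |K x y| ≤ A * Real.exp (-a * l1 (x - y)))
    {F : Pt d → ℂ} {KF : ℝ} {p : ℕ} (hF : ∀ z, ‖F z‖ ≤ KF * pw p z) (y : Pt d) :
    ‖(K x y : ℂ) * F (x - y)‖ ≤ A * KF * (wt a (x - y) * pw p (x - y)) := by
  rw [norm_mul, Complex.norm_real, Real.norm_eq_abs, wt_eq]
  calc |K x y| * ‖F (x - y)‖ ≤ (A * Real.exp (-a * l1 (x - y))) * (KF * pw p (x - y)) :=
        mul_le_mul (hK y) (hF _) (norm_nonneg _) ((abs_nonneg _).trans (hK y))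
    _ = A * KF * (Real.exp (-a * l1 (x - y)) * pw p (x - y)) := by ring

/-- **(4.34) with a complex weight**: `Σ_y K(x,y)F(x − y)` is summable over ℤᵈ with
`‖Σ_{y∈ℤᵈ} K(x,y)F(x − y)‖ ≤ A K_F S_{a,p,d}` and `‖Σ_{y∈Y} …‖ ≤ A K_F S_{a,p,d}` for every finite `Y`.
[cite: Balaban1987RG1, (4.34) p.289] -/
theorem weighted434_complex_le (ha : 0 < a) {x : Pt d}
    (hK : ∀ y, |K x y| ≤ A * Real.exp (-a * l1 (x - y))) {F : Pt d → ℂ} {KF : ℝ} {p : ℕ}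
    (hKF : 0 ≤ KF) (hF : ∀ z, ‖F z‖ ≤ KF * pw p z) :
    Summable (fun y => (K x y : ℂ) * F (x - y)) ∧
    ‖∑' y, (K x y : ℂ) * F (x - y)‖ ≤ A * KF * B12WholeLattice290.S a p d ∧
    ∀ Y : Finset (Pt d), ‖∑ y ∈ Y, (K x y : ℂ) * F (x - y)‖ ≤ A * KF * B12WholeLattice290.S a p d :=
  have hG := norm_mul_weight_le hK hF
  ⟨summable_of_shift ha x p hG, norm_tsum_le_of_shift ha x p hG,
    fun Y => norm_sum_le_of_shift ha (mul_nonneg (nonneg_of_twoPt hK) hKF) x p hG Y⟩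

/-- **The p. 290 y-extension, complex weight**: for finite `Y ⊇ {y : |x − y|₁ < R}`,
`‖Σ_{y∈ℤᵈ} K(x,y)F(x − y) − Σ_{y∈Y} K(x,y)F(x − y)‖ ≤ A K_F e^{−(a/2)R} S_{a/2,p,d}` (compare
`B12WholeLattice290.norm_tsum_sub_sum_shift_le`, the case `K(x,y) = c(x − y)`). [cite: Balaban1987RG1, p.290] -/
theorem tail434_le (ha : 0 < a) {x : Pt d} (hK : ∀ y, |K x y| ≤ A * Real.exp (-a * l1 (x - y)))
    {F : Pt d → ℂ} {KF : ℝ} {p : ℕ} (hKF : 0 ≤ KF) (hF : ∀ z, ‖F z‖ ≤ KF * pw p z) (R : ℝ)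
    (Y : Finset (Pt d)) (hY : ∀ y, l1 (x - y) < R → y ∈ Y) :
    ‖∑' y, (K x y : ℂ) * F (x - y) - ∑ y ∈ Y, (K x y : ℂ) * F (x - y)‖ ≤
      A * KF * Real.exp (-(a / 2) * R) * B12WholeLattice290.S (a / 2) p d :=
  norm_tsum_sub_sum_le_of_shift ha (mul_nonneg (nonneg_of_twoPt hK) hKF) x p
    (norm_mul_weight_le hK hF) R Y hY

end TwoPoint

/-! ## 2. «we sum the function 𝐄⁽²⁾(X) over X … because the other expressions do not depend on X»

The X-sum may be moved inside the (already infinite) y-sum: joint absolute summability. -/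

section Fubini

variable {ι : Type*} {E : ι → Pt d → Pt d → ℝ} {A a : ℝ}

/-- Uniform finite-family two-point bounds pass to the X-summed kernel: `Σ'_X 𝐄(X,x,y)` converges absolutely
and `|Σ'_X 𝐄(X,x,y)| ≤ A e^{−a|x−y|₁}` — so §1 applies to `K(x,y) := Σ'_X 𝐄(X,x,y)`. [folklore] -/
theorem twoPt_tsum_of_finset {x : Pt d}
    (hfin : ∀ (F : Finset ι) (y : Pt d), ∑ X ∈ F, |E X x y| ≤ A * Real.exp (-a * l1 (x - y)))
    (y : Pt d) :
    (Summable fun X => E X x y) ∧ |∑' X, E X x y| ≤ A * Real.exp (-a * l1 (x - y)) :=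
  summable_and_abs_tsum_le_of_sum_abs_le (fun X => E X x y) fun F => hfin F y

/-- … and to the kernel summed over any sub-class `{X : P X}`. [folklore] -/
theorem twoPt_tsum_subtype_of_finset {x : Pt d}
    (hfin : ∀ (F : Finset ι) (y : Pt d), ∑ X ∈ F, |E X x y| ≤ A * Real.exp (-a * l1 (x - y)))
    (P : ι → Prop) (y : Pt d) :
    (Summable fun X : {X : ι // P X} => E X.1 x y) ∧
      |∑' X : {X : ι // P X}, E X.1 x y| ≤ A * Real.exp (-a * l1 (x - y)) :=
  summable_and_abs_tsum_subtype_le (fun X => E X x y) P fun F => hfin F y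

/-- Finite-family bounds restrict to sub-classes. [folklore] -/
theorem finset_bound_subtype {x : Pt d}
    (hfin : ∀ (F : Finset ι) (y : Pt d), ∑ X ∈ F, |E X x y| ≤ A * Real.exp (-a * l1 (x - y)))
    (P : ι → Prop) (F : Finset {X : ι // P X}) (y : Pt d) :
    ∑ X ∈ F, |E X.1 x y| ≤ A * Real.exp (-a * l1 (x - y)) := by
  have h := hfin (F.map (Function.Embedding.subtype _)) y
  simpa only [Finset.sum_map, Function.Embedding.coe_subtype] using h

/-- Finite partial sums over PAIRS `(X, y)` of `|𝐄(X,x,y) w(y)|` are `≤ A K_w S_{a,p,d}` for a weight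
`|w(y)| ≤ K_w pw_p(x − y)`. [folklore] -/
theorem sum_pairs_le (ha : 0 < a) {x : Pt d}
    (hfin : ∀ (F : Finset ι) (y : Pt d), ∑ X ∈ F, |E X x y| ≤ A * Real.exp (-a * l1 (x - y)))
    {w : Pt d → ℝ} {KW : ℝ} {p : ℕ} (hKW : 0 ≤ KW) (hw : ∀ y, |w y| ≤ KW * pw p (x - y))
    (U : Finset (ι × Pt d)) :
    ∑ q ∈ U, |E q.1 x q.2 * w q.2| ≤ A * KW * B12WholeLattice290.S a p d := by
  classical
  have hA : ∀ y, 0 ≤ A * Real.exp (-a * l1 (x - y)) := fun y =>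
    (Finset.sum_nonneg fun X _ => abs_nonneg (E X x y)).trans (hfin ∅ y)
  have hAn : 0 ≤ A := by
    have h := hA x
    rw [sub_self] at h
    have h0 : l1 (0 : Pt d) = 0 := by simp [l1]
    rw [h0, mul_zero, Real.exp_zero, mul_one] at h
    exact h
  calc ∑ q ∈ U, |E q.1 x q.2 * w q.2|
      ≤ ∑ q ∈ U.image Prod.fst ×ˢ U.image Prod.snd, |E q.1 x q.2 * w q.2| :=
        Finset.sum_le_sum_of_subset_of_nonneg Finset.subset_product fun _ _ _ => abs_nonneg _
    _ = ∑ y ∈ U.image Prod.snd, ∑ X ∈ U.image Prod.fst, |E X x y * w y| := by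
        rw [Finset.sum_product_right]
    _ = ∑ y ∈ U.image Prod.snd, (∑ X ∈ U.image Prod.fst, |E X x y|) * |w y| := by
        refine Finset.sum_congr rfl fun y _ => ?_
        rw [Finset.sum_mul]
        exact Finset.sum_congr rfl fun X _ => abs_mul _ _
    _ ≤ ∑ y ∈ U.image Prod.snd, (A * Real.exp (-a * l1 (x - y))) * (KW * pw p (x - y)) :=
        Finset.sum_le_sum fun y _ => mul_le_mul (hfin _ y) (hw y) (abs_nonneg _) (hA y)
    _ = ∑ y ∈ U.image Prod.snd, A * KW * (wt a (x - y) * pw p (x - y)) :=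
        Finset.sum_congr rfl fun y _ => by rw [wt_eq]; ring
    _ ≤ ∑' y, A * KW * (wt a (x - y) * pw p (x - y)) :=
        ((summable_wt_pw_shift ha p x).mul_left (A * KW)).sum_le_tsum _ fun y _ =>
          mul_nonneg (mul_nonneg hAn hKW) (mul_nonneg (wt_pos _ _).le (pw_pos p _).le)
    _ = A * KW * B12WholeLattice290.S a p d := by rw [tsum_mul_left, tsum_wt_pw_shift]

/-- **Joint absolute summability in `(X, y)`** of `𝐄(X,x,y) w(y)` (Tonelli: bounded non-negative partial
sums). [folklore] -/
theorem summable_prod434 (ha : 0 < a) {x : Pt d}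
    (hfin : ∀ (F : Finset ι) (y : Pt d), ∑ X ∈ F, |E X x y| ≤ A * Real.exp (-a * l1 (x - y)))
    {w : Pt d → ℝ} {KW : ℝ} {p : ℕ} (hKW : 0 ≤ KW) (hw : ∀ y, |w y| ≤ KW * pw p (x - y)) :
    Summable fun q : ι × Pt d => E q.1 x q.2 * w q.2 :=
  (summable_of_sum_le (fun _ => abs_nonneg _) (sum_pairs_le ha hfin hKW hw)).of_abs

/-- **The X-sum inside the whole-lattice y-sum** («This means that we sum the function 𝐄⁽²⁾(X) over
X ∈ 𝐃⁰_j, because the other expressions do not depend on X», after «we extend summations over y to the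
whole lattice Z⁴»): `Σ'_X Σ_{y∈ℤᵈ} 𝐄(X,x,y) w(y) = Σ_{y∈ℤᵈ} (Σ'_X 𝐄(X,x,y)) w(y)`, every sum absolutely
convergent. [cite: Balaban1987RG1, p.290] -/
theorem fubini434 (ha : 0 < a) {x : Pt d}
    (hfin : ∀ (F : Finset ι) (y : Pt d), ∑ X ∈ F, |E X x y| ≤ A * Real.exp (-a * l1 (x - y)))
    {w : Pt d → ℝ} {KW : ℝ} {p : ℕ} (hKW : 0 ≤ KW) (hw : ∀ y, |w y| ≤ KW * pw p (x - y)) :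
    ∑' X, ∑' y, E X x y * w y = ∑' y, (∑' X, E X x y) * w y := by
  have hs : Summable (Function.uncurry fun X y => E X x y * w y) := summable_prod434 ha hfin hKW hw
  rw [← hs.tsum_comm]
  exact tsum_congr fun y => tsum_mul_right

/-- The same with the finite x-sum of (4.34) in between: `Σ'_X Σ_{x∈BF} Σ_{y∈ℤᵈ} 𝐄(X,x,y) w_x(y)
= Σ_{x∈BF} Σ_{y∈ℤᵈ} (Σ'_X 𝐄(X,x,y)) w_x(y)`. [cite: Balaban1987RG1, p.290] -/
theorem fubini434_sum (ha : 0 < a) (BF : Finset (Pt d))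
    (hfin : ∀ x ∈ BF, ∀ (F : Finset ι) (y : Pt d), ∑ X ∈ F, |E X x y| ≤ A * Real.exp (-a * l1 (x - y)))
    {w : Pt d → Pt d → ℝ} {KW : ℝ} {p : ℕ} (hKW : 0 ≤ KW)
    (hw : ∀ x ∈ BF, ∀ y, |w x y| ≤ KW * pw p (x - y)) :
    ∑' X, ∑ x ∈ BF, ∑' y, E X x y * w x y = ∑ x ∈ BF, ∑' y, (∑' X, E X x y) * w x y := by
  have hsx : ∀ x ∈ BF, Summable fun X => ∑' y, E X x y * w x y := fun x hx =>
    (summable_prod434 ha (hfin x hx) hKW (hw x hx)).prod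
  rw [Summable.tsum_finsetSum hsx]
  exact Finset.sum_congr rfl fun x hx => fubini434 ha (hfin x hx) hKW (hw x hx)

end Fubini

/-! ## 3. On 𝐃⁰_j of ℤᵈ under the kernel bound, at the printed δ₁ -/

section Lattice

variable {M : ℕ} {E2 : LDom d → Pt d → Pt d → ℝ} {CE κ δ₀ : ℝ}

/-- **Finite families of 𝐃⁰_j(ℤᵈ) obey the two-point bound uniformly** at the printed
`δ₁ = ½ min{δ₀, κ(Md)⁻¹}`: under `KernelBound E2 C_E κ δ₀` with `κ ≥ 2κ₀(4·2ᵈ, 2d)`,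
`Σ_{X∈F} |𝐄²(X,x,y)| ≤ C_E e^{3Mdδ₁} K₀(4·2ᵈ,2d) K₁(d,δ₀/2) e^{−δ₁|x−y|₁}` for every finite `F` (the budget
`δ₁Md + κ/2 ≤ κ`, `δ₁ + δ₀/2 ≤ δ₀` of `B12Ext436.SiteGeometry.sum_abs_le`). [cite: Balaban1987RG1, (5.10) p.293] -/
theorem sum_abs_latt_le (hd : 0 < d) (hM : 0 < M) (hCE : 0 ≤ CE) (hδ₀ : 0 < δ₀)
    (hκ₀ : kappa₀ (4 * 2 ^ d) (2 * d) ≤ κ / 2) (hE : (geomZ d M).KernelBound E2 CE κ δ₀)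
    (x y : Pt d) (F : Finset (LDom d)) :
    ∑ X ∈ F, |E2 X x y| ≤
      CE * Real.exp (delta1 δ₀ κ ((M : ℝ) * d) * ((M : ℝ) * d) * 3) * K₀ (4 * 2 ^ d) (2 * d) *
        K₁ d (δ₀ / 2) * Real.exp (-delta1 δ₀ κ ((M : ℝ) * d) * l1 (x - y)) := by
  have hκ : 0 ≤ κ := kappa_nonneg_of (by norm_num) hκ₀
  have hMd : (0 : ℝ) < (M : ℝ) * d := mul_pos (Nat.cast_pos.2 hM) (Nat.cast_pos.2 hd)
  have h1 := delta1_mul_le δ₀ κ hMd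
  have h2 := delta1_le_half δ₀ κ ((M : ℝ) * d)
  exact (geomZ d M).sum_abs_le (ρ := fun x y => l1 (x - y)) hCE (K₀_pos _ _).le hMd.le
    (delta1_nonneg hδ₀.le hκ hMd) (half_pos hδ₀).le (by linarith) (by linarith) hE (geomLeafZ hM)
    (cubeSumLeafZ hM (half_pos hδ₀)) (ineq126_latt d hκ₀) x y F

/-- **The kernel summed over ANY sub-class of 𝐃⁰_j(ℤᵈ) obeys the two-point bound** (print's `X ⊂ □̃²` at
the y-extension step, the far class, …): absolutely convergent and
`|Σ_{X : P X} 𝐄²(X,x,y)| ≤ C_E e^{3Mdδ₁} K₀ K₁(d,δ₀/2) e^{−δ₁|x−y|₁}`. [cite: Balaban1987RG1, (5.10) p.293] -/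
theorem twoPoint_latt_subtype (hd : 0 < d) (hM : 0 < M) (hCE : 0 ≤ CE) (hδ₀ : 0 < δ₀)
    (hκ₀ : kappa₀ (4 * 2 ^ d) (2 * d) ≤ κ / 2) (hE : (geomZ d M).KernelBound E2 CE κ δ₀)
    (P : LDom d → Prop) (x y : Pt d) :
    (Summable fun X : {X : LDom d // P X} => E2 X.1 x y) ∧
      |∑' X : {X : LDom d // P X}, E2 X.1 x y| ≤
        CE * Real.exp (delta1 δ₀ κ ((M : ℝ) * d) * ((M : ℝ) * d) * 3) * K₀ (4 * 2 ^ d) (2 * d) *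
          K₁ d (δ₀ / 2) * Real.exp (-delta1 δ₀ κ ((M : ℝ) * d) * l1 (x - y)) :=
  summable_and_abs_tsum_subtype_le (fun X => E2 X x y) P fun F =>
    sum_abs_latt_le hd hM hCE hδ₀ hκ₀ hE x y F

/-- **THE WEIGHTED y-SUMS OF (4.34) ON 𝐃⁰_j(ℤᵈ)**, kernel summed over any sub-class `{X : P X}`:
`Σ_{y∈ℤᵈ} |Σ_{X : P X} 𝐄²(X,x,y)| pw_p(x − y) ≤ A·S_{δ₁,p,d}` with `A = C_E e^{3Mdδ₁} K₀ K₁(d,δ₀/2)`, and the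
same over every finite y-range — uniformly in `x` and in the sub-class. [cite: Balaban1987RG1, (4.34) p.289–290] -/
theorem moments434_latt (hd : 0 < d) (hM : 0 < M) (hCE : 0 ≤ CE) (hδ₀ : 0 < δ₀)
    (hκ₀ : kappa₀ (4 * 2 ^ d) (2 * d) ≤ κ / 2) (hE : (geomZ d M).KernelBound E2 CE κ δ₀)
    (P : LDom d → Prop) (x : Pt d) (p : ℕ) :
    (Summable fun y => |∑' X : {X : LDom d // P X}, E2 X.1 x y| * pw p (x - y)) ∧
    ∑' y, |∑' X : {X : LDom d // P X}, E2 X.1 x y| * pw p (x - y) ≤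
      CE * Real.exp (delta1 δ₀ κ ((M : ℝ) * d) * ((M : ℝ) * d) * 3) * K₀ (4 * 2 ^ d) (2 * d) *
        K₁ d (δ₀ / 2) * B12WholeLattice290.S (delta1 δ₀ κ ((M : ℝ) * d)) p d ∧
    ∀ Y : Finset (Pt d), ∑ y ∈ Y, |∑' X : {X : LDom d // P X}, E2 X.1 x y| * pw p (x - y) ≤
      CE * Real.exp (delta1 δ₀ κ ((M : ℝ) * d) * ((M : ℝ) * d) * 3) * K₀ (4 * 2 ^ d) (2 * d) *
        K₁ d (δ₀ / 2) * B12WholeLattice290.S (delta1 δ₀ κ ((M : ℝ) * d)) p d :=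
  have ha := delta1_latt_pos hd hM two_pos hδ₀ hκ₀
  have hK : ∀ y, |∑' X : {X : LDom d // P X}, E2 X.1 x y| ≤ _ := fun y =>
    (twoPoint_latt_subtype hd hM hCE hδ₀ hκ₀ hE P x y).2
  ⟨summable_abs_mul_pw (K := fun x y => ∑' X : {X : LDom d // P X}, E2 X.1 x y) ha hK p,
    tsum_abs_mul_pw_le (K := fun x y => ∑' X : {X : LDom d // P X}, E2 X.1 x y) ha hK p,
    sum_abs_mul_pw_le (K := fun x y => ∑' X : {X : LDom d // P X}, E2 X.1 x y) ha hK p⟩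

/-- **THE THREE COEFFICIENT KERNELS OF (4.34) ON 𝐃⁰_j(ℤᵈ)** with y over the whole lattice, kernel summed over
any sub-class: `Σ_y |K| ≤ A S_{δ₁,0,d}`, `|Σ_y K(x,y)(y_κ − x_κ)| ≤ A S_{δ₁,1,d}`,
`|Σ_y K(x,y)(y_κ − x_κ)(y_λ − x_λ)| ≤ A S_{δ₁,2,d}` (`K = Σ_{X : P X} 𝐄²(X,·,·)`, `A = C_E e^{3Mdδ₁} K₀ K₁(d,δ₀/2)`),
all absolutely convergent. [cite: Balaban1987RG1, (4.34) p.289–290] -/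
theorem coeff434_latt (hd : 0 < d) (hM : 0 < M) (hCE : 0 ≤ CE) (hδ₀ : 0 < δ₀)
    (hκ₀ : kappa₀ (4 * 2 ^ d) (2 * d) ≤ κ / 2) (hE : (geomZ d M).KernelBound E2 CE κ δ₀)
    (P : LDom d → Prop) (x : Pt d) (κ' l : Fin d) :
    ∑' y, |∑' X : {X : LDom d // P X}, E2 X.1 x y| ≤
      CE * Real.exp (delta1 δ₀ κ ((M : ℝ) * d) * ((M : ℝ) * d) * 3) * K₀ (4 * 2 ^ d) (2 * d) *
        K₁ d (δ₀ / 2) * B12WholeLattice290.S (delta1 δ₀ κ ((M : ℝ) * d)) 0 d ∧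
    |∑' y, (∑' X : {X : LDom d // P X}, E2 X.1 x y) * ((y κ' - x κ' : ℤ) : ℝ)| ≤
      CE * Real.exp (delta1 δ₀ κ ((M : ℝ) * d) * ((M : ℝ) * d) * 3) * K₀ (4 * 2 ^ d) (2 * d) *
        K₁ d (δ₀ / 2) * B12WholeLattice290.S (delta1 δ₀ κ ((M : ℝ) * d)) 1 d ∧
    |∑' y, (∑' X : {X : LDom d // P X}, E2 X.1 x y) * (((y κ' - x κ' : ℤ) : ℝ) * ((y l - x l : ℤ) : ℝ))| ≤
      CE * Real.exp (delta1 δ₀ κ ((M : ℝ) * d) * ((M : ℝ) * d) * 3) * K₀ (4 * 2 ^ d) (2 * d) *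
        K₁ d (δ₀ / 2) * B12WholeLattice290.S (delta1 δ₀ κ ((M : ℝ) * d)) 2 d :=
  have ha := delta1_latt_pos hd hM two_pos hδ₀ hκ₀
  have hK : ∀ y, |∑' X : {X : LDom d // P X}, E2 X.1 x y| ≤ _ := fun y =>
    (twoPoint_latt_subtype hd hM hCE hδ₀ hκ₀ hE P x y).2
  ⟨(moment0_le (K := fun x y => ∑' X : {X : LDom d // P X}, E2 X.1 x y) ha hK).2.1,
    (moment1_le (K := fun x y => ∑' X : {X : LDom d // P X}, E2 X.1 x y) ha hK κ').2.2.1,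
    (moment2_le (K := fun x y => ∑' X : {X : LDom d // P X}, E2 X.1 x y) ha hK κ' l).2.2.1⟩

/-- **THE p. 290 y-EXTENSION ON 𝐃⁰_j(ℤᵈ)** for the kernel summed over a sub-class (not translation
invariant) and a real weight `|w(y)| ≤ K_w pw_p(x − y)`: for finite `Y ⊇ {y : |x − y|₁ < R}`,
`|Σ_{y∈ℤᵈ} K(x,y)w(y) − Σ_{y∈Y} K(x,y)w(y)| ≤ A K_w e^{−(δ₁/2)R} S_{δ₁/2,p,d}`. [cite: Balaban1987RG1, p.290] -/
theorem tail434_latt (hd : 0 < d) (hM : 0 < M) (hCE : 0 ≤ CE) (hδ₀ : 0 < δ₀)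
    (hκ₀ : kappa₀ (4 * 2 ^ d) (2 * d) ≤ κ / 2) (hE : (geomZ d M).KernelBound E2 CE κ δ₀)
    (P : LDom d → Prop) (x : Pt d) {w : Pt d → ℝ} {KW : ℝ} {p : ℕ} (hKW : 0 ≤ KW)
    (hw : ∀ y, |w y| ≤ KW * pw p (x - y)) (R : ℝ) (Y : Finset (Pt d))
    (hY : ∀ y, l1 (x - y) < R → y ∈ Y) :
    |∑' y, (∑' X : {X : LDom d // P X}, E2 X.1 x y) * w y -
        ∑ y ∈ Y, (∑' X : {X : LDom d // P X}, E2 X.1 x y) * w y| ≤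
      CE * Real.exp (delta1 δ₀ κ ((M : ℝ) * d) * ((M : ℝ) * d) * 3) * K₀ (4 * 2 ^ d) (2 * d) *
        K₁ d (δ₀ / 2) * KW * Real.exp (-(delta1 δ₀ κ ((M : ℝ) * d) / 2) * R) *
        B12WholeLattice290.S (delta1 δ₀ κ ((M : ℝ) * d) / 2) p d :=
  tail434_real_le (K := fun x y => ∑' X : {X : LDom d // P X}, E2 X.1 x y)
    (delta1_latt_pos hd hM two_pos hδ₀ hκ₀) (fun y => (twoPoint_latt_subtype hd hM hCE hδ₀ hκ₀ hE P x y).2)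
    hKW hw R Y hY

/-- **THE X-SUM INSIDE THE WHOLE-LATTICE y-SUM ON 𝐃⁰_j(ℤᵈ)** («because the other expressions do not depend
on X»), over any sub-class and for a real weight `|w(y)| ≤ K_w pw_p(x − y)`:
`Σ_{X : P X} Σ_{y∈ℤᵈ} 𝐄²(X,x,y) w(y) = Σ_{y∈ℤᵈ} (Σ_{X : P X} 𝐄²(X,x,y)) w(y)`. [cite: Balaban1987RG1, p.290] -/
theorem fubini434_latt (hd : 0 < d) (hM : 0 < M) (hCE : 0 ≤ CE) (hδ₀ : 0 < δ₀)
    (hκ₀ : kappa₀ (4 * 2 ^ d) (2 * d) ≤ κ / 2) (hE : (geomZ d M).KernelBound E2 CE κ δ₀)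
    (P : LDom d → Prop) (x : Pt d) {w : Pt d → ℝ} {KW : ℝ} {p : ℕ} (hKW : 0 ≤ KW)
    (hw : ∀ y, |w y| ≤ KW * pw p (x - y)) :
    (Summable fun q : {X : LDom d // P X} × Pt d => E2 q.1.1 x q.2 * w q.2) ∧
    ∑' X : {X : LDom d // P X}, ∑' y, E2 X.1 x y * w y =
      ∑' y, (∑' X : {X : LDom d // P X}, E2 X.1 x y) * w y :=
  have ha := delta1_latt_pos hd hM two_pos hδ₀ hκ₀
  have hfin : ∀ (F : Finset {X : LDom d // P X}) (y : Pt d), ∑ X ∈ F, |E2 X.1 x y| ≤ _ := fun F y =>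
    finset_bound_subtype (E := E2) (fun F y => sum_abs_latt_le hd hM hCE hδ₀ hκ₀ hE x y F) P F y
  ⟨summable_prod434 (E := fun (X : {X : LDom d // P X}) x y => E2 X.1 x y) ha hfin hKW hw,
    fubini434 (E := fun (X : {X : LDom d // P X}) x y => E2 X.1 x y) ha hfin hKW hw⟩

end Lattice

/-! ## 4. The replacement H_j(□₀) → H_j: «the expression of the form (4.34), but with very small
coefficients» -/

section Replacement

variable {W : Type*} [NormedAddCommGroup W] [NormedSpace ℂ W]

/-- **«THIS CHANGE INCREASES THE SUM OF THE IRRELEVANT TERMS BY THE EXPRESSION OF THE FORM (4.34), BUT WITH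
VERY SMALL COEFFICIENTS»** — as a theorem about the coefficient kernels.  Under the hypotheses of
`B12HjFree290.kernelBound_restr_sub` (both response families obey the p. 282 bound with `B₃`, their
difference on `S = supp ζ̃_□` obeys it with the small factor `η` — the [15]-input, a NAMED HYPOTHESIS), the
(4.34) coefficient kernels written for the `S×S`-restricted DIFFERENCE kernel, summed over any sub-class of
𝐃⁰_j(ℤᵈ) and with y over the whole lattice, obey
`Σ_y |D(x,y)| pw_p(x − y) ≤ (8E₀α₂⁻²B₃η)·e^{3Mdδ₁}K₀(4·2ᵈ,2d)K₁(d,δ₀/2)·S_{δ₁,p,d}` (every `p`; the monomials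
of (4.34) are the cases `p ≤ 2`, `abs_coord_le_pw`, `abs_coord2_le_pw`), and the same over every finite
y-range: the coefficients are those of (4.34) times a factor linear in `η`. [cite: Balaban1987RG1, p.290] -/
theorem coeff434_restr_sub (hd : 0 < d) {M : ℕ} (hM : 0 < M) (EX : LDom d → W → ℂ)
    (h₀ h : LDom d → Pt d → W) (E2₀ E2 : LDom d → Pt d → Pt d → ℝ) {S : Set (Pt d)}
    {α₂ E₀ B₃ η κ δ₀ : ℝ} (hα₂ : 0 < α₂) (hE₀ : 0 ≤ E₀) (hB₃ : 0 ≤ B₃) (hη : 0 ≤ η) (hδ₀ : 0 < δ₀)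
    (hκ₀ : kappa₀ (4 * 2 ^ d) (2 * d) ≤ κ / 2)
    (han : ∀ X, AnalyticOnNhd ℂ (EX X) (ball 0 α₂))
    (h118 : ∀ X, ∀ v ∈ ball (0 : W) α₂, ‖EX X v‖ ≤ E₀ * Real.exp (-κ * treeLen X.1))
    (hrepr₀ : ∀ X x y, E2₀ X x y = (mixedDeriv (EX X) (h₀ X x) (h₀ X y)).re)
    (hrepr : ∀ X x y, E2 X x y = (mixedDeriv (EX X) (h X x) (h X y)).re)
    (hh₀ : ∀ X x, ‖h₀ X x‖ ≤ B₃ * Real.exp (-δ₀ * (geomZ d M).distD x X))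
    (hh : ∀ X x, ‖h X x‖ ≤ B₃ * Real.exp (-δ₀ * (geomZ d M).distD x X))
    (hdiff : ∀ X, ∀ x ∈ S, ‖h₀ X x - h X x‖ ≤ η * Real.exp (-δ₀ * (geomZ d M).distD x X))
    (P : LDom d → Prop) (x : Pt d) (p : ℕ) :
    (Summable fun y => |∑' X : {X : LDom d // P X},
        (S ×ˢ S).indicator (fun q : Pt d × Pt d => E2₀ X.1 q.1 q.2 - E2 X.1 q.1 q.2) (x, y)| *
          pw p (x - y)) ∧
    ∑' y, |∑' X : {X : LDom d // P X},
        (S ×ˢ S).indicator (fun q : Pt d × Pt d => E2₀ X.1 q.1 q.2 - E2 X.1 q.1 q.2) (x, y)| *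
          pw p (x - y) ≤
      8 * E₀ / α₂ ^ 2 * B₃ * η *
        Real.exp (delta1 δ₀ κ ((M : ℝ) * d) * ((M : ℝ) * d) * 3) * K₀ (4 * 2 ^ d) (2 * d) *
        K₁ d (δ₀ / 2) * B12WholeLattice290.S (delta1 δ₀ κ ((M : ℝ) * d)) p d ∧
    ∀ Y : Finset (Pt d), ∑ y ∈ Y, |∑' X : {X : LDom d // P X},
        (S ×ˢ S).indicator (fun q : Pt d × Pt d => E2₀ X.1 q.1 q.2 - E2 X.1 q.1 q.2) (x, y)| *
          pw p (x - y) ≤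
      8 * E₀ / α₂ ^ 2 * B₃ * η *
        Real.exp (delta1 δ₀ κ ((M : ℝ) * d) * ((M : ℝ) * d) * 3) * K₀ (4 * 2 ^ d) (2 * d) *
        K₁ d (δ₀ / 2) * B12WholeLattice290.S (delta1 δ₀ κ ((M : ℝ) * d)) p d :=
  moments434_latt hd hM (by positivity) hδ₀ hκ₀
    (kernelBound_restr_sub (geomZ d M) EX h₀ h E2₀ E2 hα₂ hE₀ hB₃ hη han h118 hrepr₀ hrepr hh₀ hh hdiff)
    P x p

end Replacement

/-! ## 5. Print's ranges (`B12Cubes436`) and consistency with the translation-invariant case -/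

section Ranges

variable {K : Pt d → Pt d → ℝ} {A a : ℝ}

/-- **The p. 290 y-extension at print's ranges**: `x ∈ □`, y summed over a finite site set `SF` («supp ζ̃_□»)
containing `□̃³ = cthickening (3R₀) □` (sites, sup metric; collar unit `R₀`, scale dictionary of `B12Cubes436`):
for any two-point-bounded kernel and real weight `|w(y)| ≤ K_w pw_p(x − y)`,
`|Σ_{y∈ℤᵈ} K(x,y)w(y) − Σ_{y∈SF} K(x,y)w(y)| ≤ A K_w e^{−(a/2)·3R₀} S_{a/2,p,d}` — «a sum over a subset of
(□̃³)ᶜ∩Z⁴ … exponentially small coefficients», for the kernel before the X-extension. [cite: Balaban1987RG1, p.290] -/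
theorem tail434_box_le (ha : 0 < a) {B : Set (Pt d)} {R₀ : ℝ} (SF : Finset (Pt d))
    (h3 : cthickening (3 * R₀) B ⊆ ↑SF) {x : Pt d} (hx : x ∈ B)
    (hK : ∀ y, |K x y| ≤ A * Real.exp (-a * l1 (x - y)))
    {w : Pt d → ℝ} {KW : ℝ} {p : ℕ} (hKW : 0 ≤ KW) (hw : ∀ y, |w y| ≤ KW * pw p (x - y)) :
    |∑' y, K x y * w y - ∑ y ∈ SF, K x y * w y| ≤
      A * KW * Real.exp (-(a / 2) * (3 * R₀)) * B12WholeLattice290.S (a / 2) p d :=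
  tail434_real_le ha hK hKW hw (3 * R₀) SF fun _ hy => Finset.mem_coe.1 (mem_suppZeta_of_l1_lt h3 hx hy)

/-- **Consistency with the translation-invariant case**: a (5.10)-type kernel `P(x − y)` with
`|P(z)| ≤ C e^{−δ₁|z|₁}` (`B12Sec2to5.Decay510`) is a two-point-bounded kernel in the sense of §1, so §1
contains `B12WholeLattice290` §3 / `B12Cubes436` §4 (same constants `S_{a,p,d}`). [cite: Balaban1987RG1, (5.10) p.293] -/
theorem twoPt_of_decay510 {P : Pt d → ℝ} {C δ₁ : ℝ} (hP : Decay510 P C δ₁) (x y : Pt d) :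
    |(fun x y => P (x - y)) x y| ≤ C * Real.exp (-δ₁ * l1 (x - y)) :=
  hP (x - y)

end Ranges

end Literature.MathematicalPhysics.QuantumFieldTheory.Balaban1983to89.B12MomentSums434
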